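import Summits.QuantumFields.BalabanUV.T4Continuum.Support.NE7SquaredBumpNestedMeanOperator
import Summits.QuantumFields.BalabanUV.T4Continuum.Support.NE3CompetitorNestedFix
import HarnessLib

/-!
# NE7SquaredBumpNestedFix — THE SQUARED-TENT NESTED-MEAN FIX: an EXACT right inverse of the nested transported block mean `bmeanIterW L (j+1) W` at a curved background of
# the multi-level small-field class, by a dressed `tent²` bump whose coefficient solves the per-block near-scalar equation `tentMean2•c + Kop2 c = θ′ z`; skew, periodic,
# SUP-BOUNDED `‖h₀‖_∞ ≤ (2∕tentMean2)·‖θ′‖_∞ ≤ 2·64^d·‖θ′‖_∞` (file 115 of the curved (APE), F185; second brick of (T1♯))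

Cell `pub-balaban`, rung (B)+1 sub-cell t4, lineage `b2b-balaban-t4-ne7-p1` (CRUX PROVER NE7 #1 = OWNER of row NE7), generation 84; memo
`t4/b2b-balaban-t4-ne7-p1-g84/SCALAR-ROWS.md` §3.  The `tent²` TWIN of row NE3's `NE3CompetitorNestedFix` (§1–§3 there with `F₀ = 0`), over F184 `NE7SquaredBumpNestedMeanOperator`
(`cbump2W`, `tentMean2`, `Kop2`), the owner's K5-inv `NE3NearScalarSolve` and `NE3CompetitorNestedFix.starL` BY NAME.
WHY.  (T1♯) (F182∕F183) = an exact right inverse of `bmeanIterW` with sup `C_a` and covariant-Laplacian sup `C_a′ ≍ 1∕M²`.  This file delivers the right inverse with `C_a = 2∕tentMean2`;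
its covariant Laplacian (the `C¹` gain of the squared profile at the curved background) is the sequel.
WHAT ([folklore]; 0 sorry; DATA defs `sfixCoef`, `sfixW` → definition lane), multi-level small-field class (`L ≥ 2`, `W` unitary, `0 ≤ x`, `LevelSmall d L j x`, `SmallField W x`)
and the ONE smallness line `E_j ≤ 1∕2` (`E_j = 4d²(M−1)²x + 16d·loopRad(d,L,r_j)`, row NE3's `NE3TopRadiusLetters.E_le_half_of_levelSmall` in the class):
§1 `norm_Kop2_le_half`; §2 **`sfixCoef … θ′ z`** (`tentMean2•c + Kop2 c = θ′ z`; `‖c‖ ≤ (2∕tentMean2)‖θ′ z‖`; skew; `N`-periodic);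
§3 **`sfixW … θ′ := dressW M W (bump2 M (sfixCoef … θ′))`**: **`bmeanIterW_sfixW`** (`= θ′ z` EXACTLY), `sfixW_block`, `sfixW_mem_skewAdjoint`, `sfixW_add_period`,
   **`norm_sfixW_le`** (`‖sfixW θ′ y‖ ≤ tent(y)²·(2∕tentMean2)·‖θ′ (blk y)‖`) and **`norm_sfixW_le_of_sup`** (`≤ 2·64^d·s`).
HONEST FRAMING (page 1): kinematics + the owner's finite-dimensional linear algebra at one background; nothing of Bałaban's asserted; (T1♯)'s Laplacian half, (APE) on curved data
NOT proved here; NOT ONE-STEP, NOT NE7; spine 0∕9; finite T⁴ rung (B)+1 — NOT infinite volume, NOT mass gap, NOT `BetaPertH`, NOT Clay.  Continuum YM on T⁴ ⇐ BetaPertH ∧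
nine spine estimates (0/9 proved); BetaPertH ⇐ (D1) ∧ (D4) ∧ CAP+tail; G-an2-4 gates asym, D1 and NE2/3/4.
-/

set_option autoImplicit false

open scoped BigOperators Matrix.Norms.L2Operator
open Finset

namespace Summit.QuantumFields.BalabanUV.T4Continuum.NE7SquaredBumpNestedFix

open Literature.MathematicalPhysics.QuantumFieldTheory.Balaban1983to89
open B7Prop1Explicit B7Prop2Explicit
open T4AveragingDeficitWall (IsUnitaryCfg SmallField Ad)
open T4AveragingDeficitWallBoundary (periodBox mem_periodBox card_periodBox IsPeriodicCfg)
open AveragingDeficitTwoLevelPrep (prop1Radius)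
open AveragingDeficitMultiLevelPrep (tower LevelSmall)
open NE3CovariantBlockMean (bmeanW bmeanIterW)
open NE3FrameFreeSliceW (bmeanIterW_add bmeanIterW_smul)
open NE3DressedBlockField (dressW dressW_mem_skewAdjoint dressW_add_period)
open NE3TentBump (tent tent_nonneg tent_le_one)
open NE3SquaredTentBump (bump2 bump2_add_period)
open NE3CoarseInterpolant (blk_block)
open SmoothRefineBlocks (blk)
open NE3CurvedProjectedLandau (tower_eq_pow_mul)
open NE3NearScalarSolve (nearScalarInv nearScalarInv_eq nearScalarInv_map_comm gauge_injective gauge_nearScalarInv_le norm_smul_abs)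
open NE3NestedMeanBlockOperator (bmeanIterW_congr_block bmeanIterW_add_period' star_bmeanIterW)
open NE3CompetitorNestedFix (starL)
open NE7SquaredBumpNestedMeanOperator (cbump2W norm_cbump2W dressW_bump2_block tentMean2 tentMean2_pos inv_le_tentMean2 Kop2 Kop2_apply norm_Kop2_le
  star_Kop2 Kop2_add_period)
open SpreadLift (loopRad)

noncomputable section

variable {d : ℕ} {n : Type*} [Fintype n] [DecidableEq n]

section Fix

variable [Nonempty n] {L : ℕ} (hL : 2 ≤ L) (j : ℕ) {W : Site d → Fin d → (Matrix n n ℂ)ˣ} {x : ℝ}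
  (hWu : IsUnitaryCfg W) (hx : 0 ≤ x) (hsm : LevelSmall d L j x) (hWx : SmallField W x)
  (hE : 4 * (d : ℝ) ^ 2 * ((L : ℝ) ^ (j + 1) - 1) ^ 2 * x + 16 * d * loopRad d L ((prop1Radius d L)^[j] x) ≤ 1 / 2)

/-! ## §1 The half-scalar bound -/

include hL hWu hx hsm hWx hE in
/-- Under `E_j ≤ 1∕2` the squared-bump block operator is half-scalar: `‖Kop2 L j W z X‖ ≤ (tentMean2∕2)·‖X‖`. [folklore] -/
theorem norm_Kop2_le_half (z : Site d) (X : Matrix n n ℂ) : ‖Kop2 L j W z X‖ ≤ tentMean2 d (L ^ (j + 1)) / 2 * ‖X‖ := by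
  have ht := tentMean2_pos (Nat.le_trans hL (Nat.le_self_pow (Nat.succ_ne_zero j) L)) d
  refine (norm_Kop2_le hL j hWu hx hsm hWx z X).trans ?_
  have h0 : 0 ≤ tentMean2 d (L ^ (j + 1)) * ‖X‖ := by positivity
  nlinarith only [hE, h0]

/-! ## §2 The coefficient -/

/-- **THE COEFFICIENT**: per block, the solution of the near-scalar equation `tentMean2•c + Kop2 c = θ′ z`. [folklore] -/
def sfixCoef (θ' : Site d → Matrix n n ℂ) (z : Site d) : Matrix n n ℂ :=
  nearScalarInv norm_smul_abs norm_add_le (fun _ h => norm_eq_zero.1 h) (Kop2 L j W z)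
    (tentMean2_pos (Nat.le_trans hL (Nat.le_self_pow (Nat.succ_ne_zero j) L)) d).le
    (half_lt_self (tentMean2_pos (Nat.le_trans hL (Nat.le_self_pow (Nat.succ_ne_zero j) L)) d))
    (norm_Kop2_le_half hL j hWu hx hsm hWx hE z) (θ' z)

/-- **THE EQUATION**: `tentMean2 • c + Kop2 c = θ′ z`. [folklore] -/
theorem sfixCoef_eq (θ' : Site d → Matrix n n ℂ) (z : Site d) :
    tentMean2 d (L ^ (j + 1)) • sfixCoef hL j hWu hx hsm hWx hE θ' z + Kop2 L j W z (sfixCoef hL j hWu hx hsm hWx hE θ' z) = θ' z :=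
  nearScalarInv_eq _ _ _ _ _ _ _ _

/-- **THE SIZE OF THE COEFFICIENT**: `‖sfixCoef … θ′ z‖ ≤ (2∕tentMean2)·‖θ′ z‖`. [folklore] -/
theorem norm_sfixCoef_le (θ' : Site d → Matrix n n ℂ) (z : Site d) :
    ‖sfixCoef hL j hWu hx hsm hWx hE θ' z‖ ≤ 2 / tentMean2 d (L ^ (j + 1)) * ‖θ' z‖ := by
  have ht := tentMean2_pos (Nat.le_trans hL (Nat.le_self_pow (Nat.succ_ne_zero j) L)) d
  have h := gauge_nearScalarInv_le norm_smul_abs norm_add_le (fun _ h => norm_eq_zero.1 h) (Kop2 L j W z) ht.le (half_lt_self ht)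
    (norm_Kop2_le_half hL j hWu hx hsm hWx hE z) (θ' z)
  refine h.trans (le_of_eq ?_)
  field_simp
  ring

/-- The size against a sup bound of the datum: `‖sfixCoef … θ′ z‖ ≤ 2·64^d·s` (`tentMean2 ≥ 64^{−d}`). [folklore] -/
theorem norm_sfixCoef_le_of_sup (θ' : Site d → Matrix n n ℂ) {s : ℝ} (hθ : ∀ z, ‖θ' z‖ ≤ s) (z : Site d) :
    ‖sfixCoef hL j hWu hx hsm hWx hE θ' z‖ ≤ 2 * (64 : ℝ) ^ d * s := by
  have hM2 : 2 ≤ L ^ (j + 1) := Nat.le_trans hL (Nat.le_self_pow (Nat.succ_ne_zero j) L)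
  have ht := tentMean2_pos hM2 d
  have hs0 : 0 ≤ s := (norm_nonneg _).trans (hθ z)
  have hinv : 2 / tentMean2 d (L ^ (j + 1)) ≤ 2 * (64 : ℝ) ^ d := by
    rw [div_le_iff₀ ht]
    have h64 := inv_le_tentMean2 hM2 d
    have h64pos : (0 : ℝ) < (64 : ℝ) ^ d := by positivity
    calc (2 : ℝ) = 2 * (64 : ℝ) ^ d * ((64 : ℝ) ^ d)⁻¹ := by field_simp
      _ ≤ 2 * (64 : ℝ) ^ d * tentMean2 d (L ^ (j + 1)) := by gcongr
  calc ‖sfixCoef hL j hWu hx hsm hWx hE θ' z‖ ≤ 2 / tentMean2 d (L ^ (j + 1)) * ‖θ' z‖ := norm_sfixCoef_le hL j hWu hx hsm hWx hE θ' z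
    _ ≤ 2 * (64 : ℝ) ^ d * s := mul_le_mul hinv (hθ z) (norm_nonneg _) (by positivity)

/-- **SKEW DATA GIVE A SKEW COEFFICIENT** (`Kop2` commutes with `star`). [folklore] -/
theorem sfixCoef_mem_skewAdjoint (θ' : Site d → Matrix n n ℂ) (z : Site d) (hθ : θ' z ∈ skewAdjoint (Matrix n n ℂ)) :
    sfixCoef hL j hWu hx hsm hWx hE θ' z ∈ skewAdjoint (Matrix n n ℂ) := by
  have hL1 : 1 ≤ L := by omega
  rw [skewAdjoint.mem_iff] at hθ ⊢
  have hcomm : ∀ c, starL (Kop2 L j W z c) = Kop2 L j W z (starL c) := fun c => by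
    rw [NE3CompetitorNestedFix.starL_apply, NE3CompetitorNestedFix.starL_apply, star_Kop2 hL1 j hWu hx hsm hWx z c]
  have h := nearScalarInv_map_comm norm_smul_abs norm_add_le (fun _ h => norm_eq_zero.1 h) (Kop2 L j W z)
    (tentMean2_pos (Nat.le_trans hL (Nat.le_self_pow (Nat.succ_ne_zero j) L)) d).le
    (half_lt_self (tentMean2_pos (Nat.le_trans hL (Nat.le_self_pow (Nat.succ_ne_zero j) L)) d))
    (norm_Kop2_le_half hL j hWu hx hsm hWx hE z) starL hcomm (θ' z)
  rw [NE3CompetitorNestedFix.starL_apply, NE3CompetitorNestedFix.starL_apply, hθ, map_neg] at h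
  unfold sfixCoef
  exact h.symm

/-- **PERIODICITY OF THE COEFFICIENT** (`W` of period `tower L N (j+1)`, `θ′` `N`-periodic). [folklore] -/
theorem sfixCoef_add_period {N : ℕ} (hWP : IsPeriodicCfg W ((tower L N (j + 1) : ℕ) : ℤ)) {θ' : Site d → Matrix n n ℂ}
    (hθ : ∀ (z : Site d) (i : Fin d), θ' (z + (N : ℤ) • e i) = θ' z) (z : Site d) (i : Fin d) :
    sfixCoef hL j hWu hx hsm hWx hE θ' (z + (N : ℤ) • e i) = sfixCoef hL j hWu hx hsm hWx hE θ' z := by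
  have hL1 : 1 ≤ L := by omega
  have ht := tentMean2_pos (Nat.le_trans hL (Nat.le_self_pow (Nat.succ_ne_zero j) L)) d
  have h1 := sfixCoef_eq hL j hWu hx hsm hWx hE θ' (z + (N : ℤ) • e i)
  have h2 := sfixCoef_eq hL j hWu hx hsm hWx hE θ' z
  rw [Kop2_add_period hL1 j hWP z i, hθ] at h1
  have hinj := gauge_injective norm_smul_abs norm_add_le (fun _ h => norm_eq_zero.1 h) (Kop2 L j W z) ht.le (half_lt_self ht)
    (norm_Kop2_le_half hL j hWu hx hsm hWx hE z)
  apply hinj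
  simp only [LinearMap.add_apply, LinearMap.smul_apply, LinearMap.id_apply]
  rw [h1, h2]

/-! ## §3 The squared-tent nested-mean fix -/

/-- **THE SQUARED-TENT NESTED-MEAN FIX** of the coarse datum `θ′`: `dressW M W (bump2 M (sfixCoef … θ′))`, `M = L^{j+1}`. [folklore] -/
def sfixW (θ' : Site d → Matrix n n ℂ) : Site d → Matrix n n ℂ :=
  dressW (L ^ (j + 1)) W (bump2 (L ^ (j + 1)) (sfixCoef hL j hWu hx hsm hWx hE θ'))

/-- On the block of `z` the fix is the constant-coefficient dressed squared bump with coefficient `sfixCoef θ′ z`. [folklore] -/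
theorem sfixW_block (θ' : Site d → Matrix n n ℂ) (z : Site d) {v : Site d} (hv : v ∈ periodBox (d := d) (L ^ (j + 1))) :
    sfixW hL j hWu hx hsm hWx hE θ' ((((L ^ (j + 1) : ℕ) : ℤ)) • z + v)
      = cbump2W (L ^ (j + 1)) W (sfixCoef hL j hWu hx hsm hWx hE θ' z) ((((L ^ (j + 1) : ℕ) : ℤ)) • z + v) :=
  dressW_bump2_block (Nat.one_le_pow _ _ (by omega)) W _ z hv

/-- **THE NESTED TRANSPORTED MEAN OF THE FIX IS THE DATUM, EXACTLY**: `bmeanIterW L (j+1) W (sfixW … θ′) z = θ′ z`. [folklore] -/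
theorem bmeanIterW_sfixW (θ' : Site d → Matrix n n ℂ) (z : Site d) :
    bmeanIterW L (j + 1) W (sfixW hL j hWu hx hsm hWx hE θ') z = θ' z := by
  have hL1 : 1 ≤ L := by omega
  have hM1 : 1 ≤ L ^ (j + 1) := Nat.one_le_pow _ _ hL1
  set c := sfixCoef hL j hWu hx hsm hWx hE θ' with hc
  -- block locality: on the block of `z` the dressed bump is the constant-coefficient one with coefficient `c z`
  have hloc : bmeanIterW L (j + 1) W (sfixW hL j hWu hx hsm hWx hE θ') z
      = bmeanIterW L (j + 1) W (cbump2W (L ^ (j + 1)) W (c z)) z :=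
    bmeanIterW_congr_block hL1 (j + 1) W _ _ z fun v hv => dressW_bump2_block hM1 W c z hv
  have hK : bmeanIterW L (j + 1) W (cbump2W (L ^ (j + 1)) W (c z)) z = Kop2 L j W z (c z) + tentMean2 d (L ^ (j + 1)) • c z := by
    rw [Kop2_apply, sub_add_cancel]
  have heq := sfixCoef_eq hL j hWu hx hsm hWx hE θ' z
  rw [hloc, hK, add_comm (Kop2 L j W z (c z)), heq]

/-- As a function: `bmeanIterW L (j+1) W (sfixW … θ′) = θ′`. [folklore] -/
theorem bmeanIterW_sfixW_eq (θ' : Site d → Matrix n n ℂ) :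
    bmeanIterW L (j + 1) W (sfixW hL j hWu hx hsm hWx hE θ') = θ' :=
  funext fun z => bmeanIterW_sfixW hL j hWu hx hsm hWx hE θ' z

/-- **SKEWNESS**: for 𝔲(n)-valued `θ′` the fix is 𝔲(n)-valued. [folklore] -/
theorem sfixW_mem_skewAdjoint {θ' : Site d → Matrix n n ℂ} (hθ : ∀ z, θ' z ∈ skewAdjoint (Matrix n n ℂ)) (y : Site d) :
    sfixW hL j hWu hx hsm hWx hE θ' y ∈ skewAdjoint (Matrix n n ℂ) := by
  unfold sfixW
  refine dressW_mem_skewAdjoint _ hWu ?_ y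
  intro w
  unfold bump2
  exact skewAdjoint.smul_mem _ (sfixCoef_mem_skewAdjoint hL j hWu hx hsm hWx hE _ _ (hθ _))

/-- **PERIODICITY**: `W` of period `tower L N (j+1)` and `θ′` `N`-periodic ⇒ the fix has period `tower L N (j+1)`. [folklore] -/
theorem sfixW_add_period {N : ℕ} (hWP : IsPeriodicCfg W ((tower L N (j + 1) : ℕ) : ℤ)) {θ' : Site d → Matrix n n ℂ}
    (hθ : ∀ (z : Site d) (i : Fin d), θ' (z + (N : ℤ) • e i) = θ' z) (y : Site d) (τ : Fin d) :
    sfixW hL j hWu hx hsm hWx hE θ' (y + ((tower L N (j + 1) : ℕ) : ℤ) • e τ) = sfixW hL j hWu hx hsm hWx hE θ' y := by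
  have hL1 : 1 ≤ L := by omega
  have hM1 : 1 ≤ L ^ (j + 1) := Nat.one_le_pow _ _ hL1
  have htow : ((tower L N (j + 1) : ℕ) : ℤ) = ((L ^ (j + 1) * N : ℕ) : ℤ) := by rw [tower_eq_pow_mul]
  have hWP' : IsPeriodicCfg W (((L ^ (j + 1) : ℕ) : ℤ) * N) := by
    have : (((L ^ (j + 1) : ℕ) : ℤ) * N) = ((tower L N (j + 1) : ℕ) : ℤ) := by rw [htow]; push_cast; ring
    rw [this]; exact hWP
  have hbump : ∀ (x' : Site d) (i : Fin d),
      bump2 (L ^ (j + 1)) (sfixCoef hL j hWu hx hsm hWx hE θ') (x' + (((L ^ (j + 1) : ℕ) : ℤ) * N) • e i)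
        = bump2 (L ^ (j + 1)) (sfixCoef hL j hWu hx hsm hWx hE θ') x' := by
    intro x' i
    have h := bump2_add_period hM1 (sfixCoef_add_period hL j hWu hx hsm hWx hE hWP hθ) x' i
    have hc : ((L ^ (j + 1) * N : ℕ) : ℤ) = ((L ^ (j + 1) : ℕ) : ℤ) * N := by push_cast; ring
    rwa [hc] at h
  unfold sfixW
  rw [htow, show (((L ^ (j + 1) * N : ℕ) : ℤ)) = ((L ^ (j + 1) : ℕ) : ℤ) * N by push_cast; ring, dressW_add_period hM1 hWP' hbump]

/-- **THE POINTWISE SIZE**: `‖sfixW … θ′ y‖ = tent(y)²·‖sfixCoef θ′ (blk y)‖ ≤ (2∕tentMean2)·tent(y)²·‖θ′ (blk M y)‖`. [folklore] -/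
theorem norm_sfixW_le (θ' : Site d → Matrix n n ℂ) (y : Site d) :
    ‖sfixW hL j hWu hx hsm hWx hE θ' y‖ ≤ tent (L ^ (j + 1)) y ^ 2 * (2 / tentMean2 d (L ^ (j + 1)) * ‖θ' (blk (L ^ (j + 1)) y)‖) := by
  have h1 : ‖sfixW hL j hWu hx hsm hWx hE θ' y‖ = tent (L ^ (j + 1)) y ^ 2 * ‖sfixCoef hL j hWu hx hsm hWx hE θ' (blk (L ^ (j + 1)) y)‖ := by
    unfold sfixW dressW bump2
    rw [AveragingDeficitNearIdentity.Ad_real_smul, norm_smul, Real.norm_of_nonneg (sq_nonneg _),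
      AveragingDeficitTransport.norm_Ad_of_unitary ((unitaryUnits _).inv_mem (AveragingDeficitBlockDensity.btree_mem hWu _ _ _))]
  rw [h1]
  exact mul_le_mul_of_nonneg_left (norm_sfixCoef_le hL j hWu hx hsm hWx hE θ' _) (sq_nonneg _)

/-- **THE SUP SIZE**: `‖θ′‖_∞ ≤ s` ⇒ `‖sfixW … θ′ y‖ ≤ tent(y)²·2·64^d·s ≤ 2·64^d·s`. [folklore] -/
theorem norm_sfixW_le_of_sup (θ' : Site d → Matrix n n ℂ) {s : ℝ} (hθ : ∀ z, ‖θ' z‖ ≤ s) (y : Site d) :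
    ‖sfixW hL j hWu hx hsm hWx hE θ' y‖ ≤ tent (L ^ (j + 1)) y ^ 2 * (2 * (64 : ℝ) ^ d * s) ∧
      ‖sfixW hL j hWu hx hsm hWx hE θ' y‖ ≤ 2 * (64 : ℝ) ^ d * s := by
  have hM1 : 1 ≤ L ^ (j + 1) := Nat.one_le_pow _ _ (by omega)
  have hs0 : 0 ≤ s := (norm_nonneg _).trans (hθ 0)
  have h1 : ‖sfixW hL j hWu hx hsm hWx hE θ' y‖ = tent (L ^ (j + 1)) y ^ 2 * ‖sfixCoef hL j hWu hx hsm hWx hE θ' (blk (L ^ (j + 1)) y)‖ := by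
    unfold sfixW dressW bump2
    rw [AveragingDeficitNearIdentity.Ad_real_smul, norm_smul, Real.norm_of_nonneg (sq_nonneg _),
      AveragingDeficitTransport.norm_Ad_of_unitary ((unitaryUnits _).inv_mem (AveragingDeficitBlockDensity.btree_mem hWu _ _ _))]
  have h2 : ‖sfixW hL j hWu hx hsm hWx hE θ' y‖ ≤ tent (L ^ (j + 1)) y ^ 2 * (2 * (64 : ℝ) ^ d * s) := by
    rw [h1]
    exact mul_le_mul_of_nonneg_left (norm_sfixCoef_le_of_sup hL j hWu hx hsm hWx hE θ' hθ _) (sq_nonneg _)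
  have ht1 : tent (L ^ (j + 1)) y ^ 2 ≤ 1 := pow_le_one₀ (tent_nonneg hM1 y) (tent_le_one hM1 y)
  refine ⟨h2, h2.trans ?_⟩
  calc tent (L ^ (j + 1)) y ^ 2 * (2 * (64 : ℝ) ^ d * s) ≤ 1 * (2 * (64 : ℝ) ^ d * s) := by gcongr
    _ = 2 * (64 : ℝ) ^ d * s := one_mul _

end Fix

end

end Summit.QuantumFields.BalabanUV.T4Continuum.NE7SquaredBumpNestedFix
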